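/-
Origin: expansion seat `planner-pub-hodgecm-mc-axioms-1-g14-0`, handover #W238 2026-08-20T15:53:55Z md5 e6605960e1cc (PKG d327acfde2cd → e6605960e1cc; 124 l.; MECHANICAL (iib-R) rewrite v3.1 of the PKG file as it stands (15 token edits; rules R1x1+RX[h₂]x14)) (`HOME/mc/pub-hodgecm-mc-axioms-1-g14/revendor/kit-r55/stage55/HodgeCM/Model/Binders/Gen12PinsTotalA.lean`, md5 e6605960e1cc, 124 lines);
landed by the gen-22 packager (p-g22) in gate run 55 REPLACES the earlier landed copy of `HodgeCM/Model/Binders/Gen12PinsTotalA.lean` (seat copy carried the packager Origin header of an earlier run (stripped)).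
-/
/-
Origin: speedrun cell pub-hodgecm, MODEL-CONSTRUCTION sub-cell, unit pub-hodgecm-mc-binder-1-g9 (BINDER PROVER, gen 9; node B2-meet,
BINDER-OWNERS row 14 CLOSED at the pins of record once theta-3's (E1) `A := fun V c k => archLineInputOf (𝔄 V c) k` is installed),
seat prover-pub-hodgecm-mc-binder-1-g9-0, 2026-08-19.
Target in PKG: HodgeCM/Model/Binders/Gen12PinsTotalA.lean (NEW additive leaf, RUN 38+: imports #26 `Binders/Gen12PinsTotal` (RUN 37) and theta-3's
`Model/ArchLineInputOf` ((E1), RUN 38/39); nothing landed imports it).  KERNEL ONLY: two theorems; 0 records of published theorems, nothing cited,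
0 `def … : Prop`, MODEL-N ±0, E unchanged.
-/
import Summits.HodgeConjecture.HodgeCM.Model.Binders.Gen12PinsTotal
import Summits.HodgeConjecture.HodgeCM.Model.ArchLineInputOf

/-!
# Row `gen12` with NO residual hypothesis at the pins of record `(Wg …, SInstance.S … @A, A := archLineInputOf ∘ 𝔄)`

#26 `Gen12Pins.gen12_totalE hN1g` delivers E's binder `gen12` at the TOTAL pins from the ONE guarded literal check
`hN1g : ∀ V c, GoodCtx → ∀ k ∈ {0,1}, (A V c k).w = archWeight L (μ c k)`.  model1's TYPE RULING (A-μ)(i) (2026-08-19T22:27:03Z) fixed the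
`A` pin of record as `A := fun V c k => archLineInputOf (𝔄 V c) k` over ONE corollary variable, the archimedean line datum family
`𝔄 : ∀ V c, ArchSideTerm.ArchLineDatum V c.D (hGR V c) (hGR₀ V c) (hGR₁ V c) (hGR₂ V c) (hGR₃ V c) (η V c) (μ c)` (theta-3 `Model/ArchLineInputOf`,
a DATA family — inhabitable, (R1′)), whose records carry `w := archWeight L (μ c k)` LITERALLY (`archLineInputOf_w`, `rfl`).  Hence at that pin
(N1) is `rfl` for EVERY `k` and every context, and row 14 closes with no hypothesis left:

* `hN1g_archLine 𝔄` — the guarded (N1)₀,₁ at `A := fun V c k => archLineInputOf (𝔄 V c) k`, by `rfl`;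
* **`gen12_totalA 𝔄`** — `∀ V c, (pinT …).GoodCtx ι₁ c → Module.finrank ℚ c.K = 6 → Nonempty ((pinT …).Gen12FunBridge V c)` at
  `(Wg @hGR @η @hη @hηc @τSyl @TSyl @hTSyl, SInstance.S @hGR @η @hη @hηc @hGR₀ @hGR₁ @hGR₂ @hGR₃ (fun V c k => archLineInputOf (𝔄 V c) k))`;
* **`gen12_totalAE 𝔄`** — the same in E's own `thetaModelOf …` text (E's binder `gen12` VERBATIM at the pins), proof definitional.
Nothing here is a claim of the manuscripts under adjudication.
-/

set_option autoImplicit false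

noncomputable section

open MeasureTheory NumberField MulAction
open scoped Matrix InnerProductSpace

namespace HodgeCM.Model

open HodgeCM HodgeCM.Universe HodgeCM.Adelic
open Literature.NumberTheory.Weil1964
open Literature.NumberTheory.Automorphic (piSchwartzBruhat)
open Literature.NumberTheory.Automorphic.UnitaryGroup (archIsotropy archIsotropyProj archKappa archSectionU21CM)
open Literature.NumberTheory.GelbartRogawski1991.UnitaryDualPair
open Literature.RepresentationTheory.HeisenbergGroup
open Literature.Geometry.ComplexHyperbolic.BallModel (U21 x₀ Jac)
open Literature.AlgebraicGeometry.HodgeTheory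
open Literature.NumberTheory.Automorphic.PicardCM
open Literature.NumberTheory.Transcendental (Arapura2012_Cor_15_4_6)
open HodgeCM.Model.ThetaSpace
open HodgeCM.Model.ArchSideTerm

namespace Gen12Pins

variable
  (hGR : ∀ {L : CMField} {ι₁ : L →+* ℂ} (V : HermSpace3 L ι₁) (c : SeesawCtx L),
    (cmSplittingDatum (L : Type) finProdFinEquiv (frameD V) (frameD_real V) (frameD_ne V) (dW c.D) (dW_real c.D)
      (dW_ne c.D)).CompatibleSplitting)
  (η : ∀ {L : CMField} {ι₁ : L →+* ℂ} (V : HermSpace3 L ι₁) (c : SeesawCtx L),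
    CMAdelic (L : Type) (frameD V) × CMAdelic (L : Type) (dW c.D) →* ℂˣ)
  (hη : ∀ {L : CMField} {ι₁ : L →+* ℂ} (V : HermSpace3 L ι₁) (c : SeesawCtx L),
    ∀ γU ∈ CMRat (L : Type) (frameD V), ∀ γ ∈ CMRat (L : Type) (dW c.D), η V c (γU, γ) = 1)
  (hηc : ∀ {L : CMField} {ι₁ : L →+* ℂ} (V : HermSpace3 L ι₁) (c : SeesawCtx L), Continuous fun p => ((η V c p : ℂˣ) : ℂ))
  (hGR₀ : ∀ {L : CMField} {ι₁ : L →+* ℂ} (V : HermSpace3 L ι₁) (c : SeesawCtx L),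
    (cmSplittingDatum (L : Type) (e₁) (frameD V) (frameD_real V) (frameD_ne V) (lineVec (L : Type) (dW c.D 0))
      (fun _ => dW_real c.D 0) (fun _ => dW_ne c.D 0)).CompatibleSplitting)
  (hGR₁ : ∀ {L : CMField} {ι₁ : L →+* ℂ} (V : HermSpace3 L ι₁) (c : SeesawCtx L),
    (cmSplittingDatum (L : Type) (e₁) (frameD V) (frameD_real V) (frameD_ne V) (lineVec (L : Type) (dW c.D 1))
      (fun _ => dW_real c.D 1) (fun _ => dW_ne c.D 1)).CompatibleSplitting)
  (hGR₂ : ∀ {L : CMField} {ι₁ : L →+* ℂ} (V : HermSpace3 L ι₁) (c : SeesawCtx L),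
    (cmSplittingDatum (L : Type) (e₁) (frameD V) (frameD_real V) (frameD_ne V) (lineVec (L : Type) (dW' c.D 0))
      (fun _ => dW'_real c.D 0) (fun _ => dW'_ne c.D 0)).CompatibleSplitting)
  (hGR₃ : ∀ {L : CMField} {ι₁ : L →+* ℂ} (V : HermSpace3 L ι₁) (c : SeesawCtx L),
    (cmSplittingDatum (L : Type) (e₁) (frameD V) (frameD_real V) (frameD_ne V) (lineVec (L : Type) (dW' c.D 1))
      (fun _ => dW'_real c.D 1) (fun _ => dW'_ne c.D 1)).CompatibleSplitting)

variable (hHD : exists_isReal_hodgeModel) (hI : hodgePQ_independent_of_hodgeModel)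
  (h₁ : BallQuotientUniformised)  (h₃ : CMAbelianVarietyRealised)
  (h : Bool) (hA : Arapura2012_Cor_15_4_6) (μ : ∀ {L : CMField}, SeesawCtx L → Fin 4 → InfinitePlace L → ℤ)
  (𝔄 : ∀ {L : CMField} {ι₁ : L →+* ℂ} (V : HermSpace3 L ι₁) (c : SeesawCtx L),
    ArchLineDatum V c.D (hGR V c) (hGR₀ V c) (hGR₁ V c) (hGR₂ V c) (hGR₃ V c) (η V c) (μ c))

/-- **(N1) at the `A` pin of record is `rfl`**: the guarded literal check (N1)₀,₁ of #26 `gen12_totalE`, at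
`A := fun V c k => archLineInputOf (𝔄 V c) k`, for every context (the `GoodCtx` guard and `k ∈ {0,1}` are not even used). -/
theorem hN1g_archLine :
    ∀ {L : CMField} {ι₁ : L →+* ℂ} (V : HermSpace3 L ι₁) (c : SeesawCtx L),
      (pinT hHD hI h₁ h₃ h hA (Wg @hGR @η @hη @hηc @τSyl @TSyl @hTSyl)
          (SInstance.S @hGR @η @hη @hηc @hGR₀ @hGR₁ @hGR₂ @hGR₃ (fun V c k => archLineInputOf (𝔄 V c) k)) μ).GoodCtx ι₁ c →
        ∀ k : Fin 4, k = 0 ∨ k = 1 → (archLineInputOf (𝔄 V c) k).w = ⇑(archWeight L (μ c k)) :=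
  fun _ _ _ _ _ => rfl

/-- **Row 14 (`gen12`) at the pins of record with NO residual hypothesis** (quantified `pinT` form): #26 `gen12_total` at
`A := fun V c k => archLineInputOf (𝔄 V c) k`, (N1) discharged by `hN1g_archLine`. -/
theorem gen12_totalA :
    ∀ {L : CMField} {ι₁ : L →+* ℂ} (V : HermSpace3 L ι₁) (c : SeesawCtx L),
      (pinT hHD hI h₁ h₃ h hA (Wg @hGR @η @hη @hηc @τSyl @TSyl @hTSyl)
          (SInstance.S @hGR @η @hη @hηc @hGR₀ @hGR₁ @hGR₂ @hGR₃ (fun V c k => archLineInputOf (𝔄 V c) k)) μ).GoodCtx ι₁ c →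
      Module.finrank ℚ c.K = 6 →
      Nonempty ((pinT hHD hI h₁ h₃ h hA (Wg @hGR @η @hη @hηc @τSyl @TSyl @hTSyl)
          (SInstance.S @hGR @η @hη @hηc @hGR₀ @hGR₁ @hGR₂ @hGR₃ (fun V c k => archLineInputOf (𝔄 V c) k)) μ).Gen12FunBridge V c) :=
  gen12_total @hGR @η @hη @hηc @hGR₀ @hGR₁ @hGR₂ @hGR₃ (fun V c k => archLineInputOf (𝔄 V c) k) hHD hI h₁ h₃ h hA @μ
    (hN1g_archLine @hGR @η @hη @hηc @hGR₀ @hGR₁ @hGR₂ @hGR₃ hHD hI h₁ h₃ h hA @μ @𝔄)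

/-- **E's binder `gen12` VERBATIM at the pins of record, NO residual hypothesis** — in E's own `thetaModelOf …` text
(`Model/E2InstanceR15A.lean`), at `W := Wg …`, `S := SInstance.S … (fun V c k => archLineInputOf (𝔄 V c) k)`; proof definitional
(`pinT_eq_thetaModel` is `rfl`). -/
theorem gen12_totalAE :
    ∀ {L : CMField} {ι₁ : L →+* ℂ} (V : HermSpace3 L ι₁) (c : SeesawCtx L),
      (thetaModelOf hHD hI h₁ h₃ h (embOf hHD hI h₁ h₃) (coverOf hHD hI h₁ h₃ hA) (wmOfInput (Wg @hGR @η @hη @hηc @τSyl @TSyl @hTSyl))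
        (thetaOf _ (thetaClassInputOf _ (fun V c => thetaSpaceInputOf hHD hI h₁ h₃
          (SInstance.S @hGR @η @hη @hηc @hGR₀ @hGR₁ @hGR₂ @hGR₃ (fun V c k => archLineInputOf (𝔄 V c) k)) V c))) (d12Of μ) (d34Of μ)).GoodCtx ι₁ c →
      Module.finrank ℚ c.K = 6 →
      Nonempty ((thetaModelOf hHD hI h₁ h₃ h (embOf hHD hI h₁ h₃) (coverOf hHD hI h₁ h₃ hA) (wmOfInput (Wg @hGR @η @hη @hηc @τSyl @TSyl @hTSyl))
        (thetaOf _ (thetaClassInputOf _ (fun V c => thetaSpaceInputOf hHD hI h₁ h₃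
          (SInstance.S @hGR @η @hη @hηc @hGR₀ @hGR₁ @hGR₂ @hGR₃ (fun V c k => archLineInputOf (𝔄 V c) k)) V c))) (d12Of μ) (d34Of μ)).Gen12FunBridge V c) :=
  fun V c hc hK => gen12_totalA @hGR @η @hη @hηc @hGR₀ @hGR₁ @hGR₂ @hGR₃ hHD hI h₁ h₃ h hA @μ @𝔄 V c hc hK

end Gen12Pins

end HodgeCM.Model

end
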